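import Mathlib

/-!
# P6Dim8Packing — the finite bookkeeping of proofs/P6-Dim8PreprintPacking.md (Theorems 1–2), kernel-checked

Model. An ITEM is a pair `(g, a) : ℕ × ℕ`: a CM factor (or an auxiliary elliptic curve `E_k`) of dimension `g`
together with the multiplicity `a = |fibre ∩ Φ|` of the `k`-fibre used (`a ≤ g`; the conjugate fibre has
multiplicity `g − a`). A GROUP is a list of items; it is ADMISSIBLE when it is the `k`-fibre of a sub-product of
`k`-Weil type of dimension 4 or 6 (multiplicity sum = half the dimension sum), or a balanced pair of dimension 2
(multiplicity sum 1). A STRUCTURE is the list of the factors' items `(g_j, a_j)` (the a-vector of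
P5-Dim8Census v1 §2.2). A PACKING with `q` auxiliaries is a list of admissible groups whose concatenation is a
permutation of the structure's items together with the two fibres `(1, 1)` and `(1, 0)` of each auxiliary copy of
`E_k` (auxiliaries come in conjugate pairs).

Checked by `decide`: the five explicit packings of P6-Dim8PreprintPacking §2 for the rows (4,4) a = (3,1),
(4,3,1) a = (3,1,0) and (1,2,1), (5,3) a = (2,2). Proved in general (`no_big_item`): an admissible group containing an
item of dimension `g ≥ 5` forces `g ∈ {5, 6}`, `a = 3` when `g = 6`, and `a ∈ {2, 3}` when `g = 5`; hence
(`no_packing_71`, `no_packing_611`, `no_packing_5111_a`, `no_packing_5111_b`) the rows (7,1), (6,1,1) a = (4,0,0)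
and (5,1,1,1) a = (4,0,0,0) / (1,1,1,1) admit no packing of this shape, for any number of auxiliaries.

Supporting artefact only (R-5): finite combinatorics, never the discharge of a Hodge-theoretic step; the
algebraicity content (S9a, S9b, Lemma 1.1 of the note) is not formalised here.
-/

namespace HodgeRepro0.P6Dim8Packing

/-- An item `(dimension, multiplicity of the fibre used)`. -/
abbrev Item := ℕ × ℕ

/-- The total dimension of a group. -/
def dimSum (G : List Item) : ℕ := (G.map Prod.fst).sum

/-- The total multiplicity of a group. -/
def multSum (G : List Item) : ℕ := (G.map Prod.snd).sum

/-- Admissible group: a balanced pair (dimension 2, multiplicity 1), or the `k`-fibre of a `k`-Weil sub-product of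
dimension 4 (S9a) or 6 (S9b): multiplicity sum = half the dimension sum. -/
def Admissible (G : List Item) : Prop :=
  (dimSum G = 2 ∨ dimSum G = 4 ∨ dimSum G = 6) ∧ 2 * multSum G = dimSum G

/-- Admissibility is decidable (two sums of naturals). -/
instance : DecidablePred Admissible := fun G => by unfold Admissible; infer_instance

/-- The items contributed by `q` auxiliary copies of `E_k`: the `s`-fibre `(1, 1)` and the `s̄`-fibre `(1, 0)`
of each copy. -/
def aux (q : ℕ) : List Item := List.replicate q (1, 1) ++ List.replicate q (1, 0)

/-- A packing of the structure `S` with `q` auxiliaries: admissible groups whose concatenation is a permutation of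
`S ++ aux q` (every factor used once with its `s`-fibre; every auxiliary used with both fibres). -/
def IsPacking (S : List Item) (q : ℕ) (P : List (List Item)) : Prop :=
  (∀ G ∈ P, Admissible G) ∧ P.flatten.Perm (S ++ aux q)

/-- Being a packing is decidable (finitely many groups; permutation of lists of naturals). -/
instance (S : List Item) (q : ℕ) (P : List (List Item)) : Decidable (IsPacking S q P) := by
  unfold IsPacking; infer_instance

/-! ## Theorem 1: the explicit packings (P6-Dim8PreprintPacking §2) -/

/-- (4,4), a = (3,1): `D × E × E′` with the conjugate fibres of two auxiliaries (3 + 0 + 0, S9b) and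
`D′ × E × E′` (1 + 1 + 1, S9b). -/
theorem pack_44 :
    IsPacking [(4, 3), (4, 1)] 2 [[(4, 3), (1, 0), (1, 0)], [(4, 1), (1, 1), (1, 1)]] := by decide

/-- (4,3,1), a = (3,1,0): `D × Ē × Ē′` (S9b), `C × E` (1 + 1, S9a), the divisor pair `{e₁, e′}` (0 + 1). -/
theorem pack_431_a :
    IsPacking [(4, 3), (3, 1), (1, 0)] 2 [[(4, 3), (1, 0), (1, 0)], [(3, 1), (1, 1)], [(1, 0), (1, 1)]] := by
  decide

/-- (4,3,1), a = (1,2,1): `D × E × E′` (1 + 1 + 1, S9b), `C × Ē` (2 + 0, S9a), the divisor pair `{e₁, ē′}` (1 + 0). -/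
theorem pack_431_b :
    IsPacking [(4, 1), (3, 2), (1, 1)] 2 [[(4, 1), (1, 1), (1, 1)], [(3, 2), (1, 0)], [(1, 1), (1, 0)]] := by
  decide

/-- (5,3), a = (2,2): `A₅ × E` (2 + 1, S9b) and `C × Ē` (2 + 0, S9a), one auxiliary. -/
theorem pack_53 : IsPacking [(5, 2), (3, 2)] 1 [[(5, 2), (1, 1)], [(3, 2), (1, 0)]] := by decide

/-! ## Theorem 2: the obstruction -/

/-- Items are honest: positive dimension and multiplicity at most the dimension. -/
def Honest (x : Item) : Prop := 1 ≤ x.1 ∧ x.2 ≤ x.1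

/-- Honesty is decidable. -/
instance : DecidablePred Honest := fun x => by unfold Honest; infer_instance

/-- The dimension sum of `x :: G`. -/
theorem dimSum_cons (x : Item) (G : List Item) : dimSum (x :: G) = x.1 + dimSum G := by
  simp [dimSum]

/-- The multiplicity sum of `x :: G`. -/
theorem multSum_cons (x : Item) (G : List Item) : multSum (x :: G) = x.2 + multSum G := by
  simp [multSum]

/-- The dimension sum is invariant under permutation. -/
theorem dimSum_perm {G G' : List Item} (h : G.Perm G') : dimSum G = dimSum G' := by
  unfold dimSum; exact (h.map Prod.fst).sum_eq

/-- The multiplicity sum is invariant under permutation. -/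
theorem multSum_perm {G G' : List Item} (h : G.Perm G') : multSum G = multSum G' := by
  unfold multSum; exact (h.map Prod.snd).sum_eq

/-- In an honest group every item has dimension at least one, so the dimension sum bounds the length. -/
theorem length_le_dimSum (G : List Item) (hG : ∀ x ∈ G, Honest x) : G.length ≤ dimSum G := by
  induction G with
  | nil => simp [dimSum]
  | cons x G ih =>
    rw [List.length_cons, dimSum_cons]
    have hx := (hG x (List.mem_cons_self ..)).1
    have := ih (fun y hy => hG y (List.mem_cons_of_mem _ hy))
    omega

/-- In an honest group the multiplicity sum is at most the dimension sum. -/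
theorem multSum_le_dimSum (G : List Item) (hG : ∀ x ∈ G, Honest x) : multSum G ≤ dimSum G := by
  induction G with
  | nil => simp [dimSum, multSum]
  | cons x G ih =>
    rw [multSum_cons, dimSum_cons]
    have hx := (hG x (List.mem_cons_self ..)).2
    have := ih (fun y hy => hG y (List.mem_cons_of_mem _ hy))
    omega

/-- THE OBSTRUCTION. An admissible honest group containing an item of dimension `g` and multiplicity `a` has
`g ≤ 6`; if `g = 6` the group is that item alone and `a = 3`; if `g = 5` the group is the item plus one elliptic
item and `a ∈ {2, 3}`. -/
theorem no_big_item (G : List Item) (hG : Admissible G) (hon : ∀ x ∈ G, Honest x) (g a : ℕ)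
    (h : (g, a) ∈ G) : g ≤ 6 ∧ (g = 6 → a = 3) ∧ (g = 5 → a = 2 ∨ a = 3) := by
  obtain ⟨hd, hm⟩ := hG
  have hperm : G.Perm ((g, a) :: G.erase (g, a)) := List.perm_cons_erase h
  have hon' : ∀ x ∈ G.erase (g, a), Honest x := fun x hx => hon x (List.mem_of_mem_erase hx)
  have hd' := dimSum_perm hperm
  have hm' := multSum_perm hperm
  rw [dimSum_cons] at hd'
  rw [multSum_cons] at hm'
  have hlen := length_le_dimSum _ hon'
  have hmd := multSum_le_dimSum _ hon'
  have hga : a ≤ g := (hon _ h).2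
  -- the case analysis is arithmetic once the erased list is seen to be empty or a single elliptic item
  refine ⟨by omega, ?_, ?_⟩
  · intro hg
    subst hg
    have hrest : dimSum (G.erase (6, a)) = 0 := by omega
    have hrest' : multSum (G.erase (6, a)) = 0 := by omega
    omega
  · intro hg
    subst hg
    have hrest : dimSum (G.erase (5, a)) = 1 := by omega
    have hrest' : multSum (G.erase (5, a)) ≤ 1 := by omega
    omega

/-- Every item of `aux q` is honest. -/
theorem honest_aux (q : ℕ) : ∀ x ∈ aux q, Honest x := by
  intro x hx
  unfold aux at hx
  rcases List.mem_append.1 hx with h | h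
  · rw [List.eq_of_mem_replicate h]; exact ⟨le_refl _, le_refl _⟩
  · rw [List.eq_of_mem_replicate h]; exact ⟨le_refl _, Nat.zero_le _⟩

/-- If a structure's items are honest, every item of every group of a packing is honest. -/
theorem honest_of_packing {S : List Item} {q : ℕ} {P : List (List Item)} (hS : ∀ x ∈ S, Honest x)
    (hP : IsPacking S q P) : ∀ G ∈ P, ∀ x ∈ G, Honest x := by
  intro G hG x hx
  have hx' : x ∈ P.flatten := List.mem_flatten.2 ⟨G, hG, hx⟩
  have hx'' : x ∈ S ++ aux q := hP.2.mem_iff.1 hx'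
  rcases List.mem_append.1 hx'' with h | h
  · exact hS x h
  · exact honest_aux q x h

/-- The group of a packing that holds a given item of the structure. -/
theorem group_of_item {S : List Item} {q : ℕ} {P : List (List Item)} (hP : IsPacking S q P) {x : Item}
    (hx : x ∈ S) : ∃ G ∈ P, x ∈ G := by
  have : x ∈ P.flatten := hP.2.symm.mem_iff.1 (List.mem_append_left _ hx)
  exact List.mem_flatten.1 this

/-- (7,1), a = (4,0) or (3,1): no packing — the sevenfold fits into no group of dimension ≤ 6. -/
theorem no_packing_71 (a : ℕ) (ha : 3 ≤ a ∧ a ≤ 4) (q : ℕ) (P : List (List Item)) :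
    ¬ IsPacking [(7, a), (1, 4 - a)] q P := by
  intro hP
  have hS : ∀ x ∈ [(7, a), (1, 4 - a)], Honest x := by
    intro x hx
    simp only [List.mem_cons, List.not_mem_nil, or_false] at hx
    rcases hx with rfl | rfl
    · exact ⟨by norm_num, by omega⟩
    · exact ⟨le_refl _, by omega⟩
  obtain ⟨G, hG, hmem⟩ := group_of_item hP (List.mem_cons_self ..)
  have := no_big_item G (hP.1 G hG) (honest_of_packing hS hP G hG) 7 a hmem
  omega

/-- (6,1,1), a = (4,0,0): no packing — a sixfold group is the sixfold alone, balanced only for a = 3. -/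
theorem no_packing_611 (q : ℕ) (P : List (List Item)) : ¬ IsPacking [(6, 4), (1, 0), (1, 0)] q P := by
  intro hP
  have hS : ∀ x ∈ [(6, 4), (1, 0), (1, 0)], Honest x := by decide
  obtain ⟨G, hG, hmem⟩ := group_of_item hP (List.mem_cons_self ..)
  have := no_big_item G (hP.1 G hG) (honest_of_packing hS hP G hG) 6 4 hmem
  omega

/-- (5,1,1,1), a = (4,0,0,0): no packing — a fivefold group needs a ∈ {2, 3}. -/
theorem no_packing_5111_a (q : ℕ) (P : List (List Item)) :
    ¬ IsPacking [(5, 4), (1, 0), (1, 0), (1, 0)] q P := by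
  intro hP
  have hS : ∀ x ∈ [(5, 4), (1, 0), (1, 0), (1, 0)], Honest x := by decide
  obtain ⟨G, hG, hmem⟩ := group_of_item hP (List.mem_cons_self ..)
  have := no_big_item G (hP.1 G hG) (honest_of_packing hS hP G hG) 5 4 hmem
  omega

/-- (5,1,1,1), a = (1,1,1,1): no packing — a fivefold group needs a ∈ {2, 3}. -/
theorem no_packing_5111_b (q : ℕ) (P : List (List Item)) :
    ¬ IsPacking [(5, 1), (1, 1), (1, 1), (1, 1)] q P := by
  intro hP
  have hS : ∀ x ∈ [(5, 1), (1, 1), (1, 1), (1, 1)], Honest x := by decide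
  obtain ⟨G, hG, hmem⟩ := group_of_item hP (List.mem_cons_self ..)
  have := no_big_item G (hP.1 G hG) (honest_of_packing hS hP G hG) 5 1 hmem
  omega

end HodgeRepro0.P6Dim8Packing
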